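import Mathlib
import Summits.ValiantsHypothesis.ValiantsHypothesis.Theses.RigidityForcesSymmetry
import Summits.ValiantsHypothesis.ValiantsHypothesis.Theorems.RigidityForcesSymmetryRankRigidMinimalReprLaplaceDefs
import Summits.ValiantsHypothesis.ValiantsHypothesis.Theorems.LaplaceOptimalFive.Negative.LaplaceFiveBorder

/-!
# Crux idea `doubling-stratum-residue` for `LaplaceOptimalFive` (stmt-ValiantsHypothesis-24813) — sketch

Ideator val-idea-19 g4 (crux-ideate style).  `LaplaceOptimalFive` is OPEN; nothing here proves it, and VP ≠ VNP is
NOT proved.  What this file checks: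

* `pairCount` / `IsDoubling` — the DOUBLING STRATUM `Δ₅` = words `v : Fin 5 → Fin 5` of content type `(2,2,1)`
  (exactly two coincident slot pairs; 900 of the 3125 words).
* `starDefect2_on_doubling` (kernel, `decide`) — CALIBRATION: the defect `E` of the certified star border family
  (`LaplaceFiveBorder.laplaceOptimal_five_border`, p629937: nine pair terms, weight 108, `Σ = P₅ + ε·E`) is supported
  on `Δ₅` only (`starDefect2 = 2·E`).  Hence the nine terms at `ε = 1` solve ALL 2225 non-`Δ₅` equations of `P₅`
  exactly with weight 108 < 120: any proof of `LaplaceOptimalFive` must read the `(2,2,1)`-words.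
* `star_at_one` (kernel, `decide`) — the nine star terms at `ε = 1` sum to `P₅ + E` exactly (integer form, doubled).
* `laplaceOptimalFive_iff_doublingResidue` (proved) — the RESIDUE FORM: `LaplaceOptimalFive` ⟺ every cheap system that
  is exact off `Δ₅` leaves a non-zero residue on `Δ₅`.
* stubs (sorried, the line's targets): `stub_star_residue_ne_zero` (K1, the star profile), `stub_onShell_five` (K2, the
  on-shell rung), `stub_star_offDoubling_witness` (P1, re-derivation of p629937 at `ε = 1` in residue form).
-/

set_option linter.dupNamespace false
set_option linter.style.longLine false

open Finset
open Summit.ValiantsHypothesis.ValiantsHypothesis.Theorems.RigidityForcesSymmetryRankRigidMinimalRepr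
open Summit.ValiantsHypothesis.ValiantsHypothesis.Theorems.LaplaceOptimalFiveNegative.LaplaceFiveBorder

namespace Summit.ValiantsHypothesis.ValiantsHypothesis.Cruxes.LaplaceOptimalFive.DoublingStratumResidue

/-- Number of coincident slot pairs of the word `(a,b,c,d,e)`; content types: injective 0, (2,1,1,1) 1, (2,2,1) 2,
(3,1,1) 3, (3,2) 4, (4,1) 6, (5) 10 — so `pairCount = 2` characterises the doubling stratum `Δ₅`. -/
def pairCount (a b c d e : Fin 5) : ℕ :=
  (if a = b then 1 else 0) + (if a = c then 1 else 0) + (if a = d then 1 else 0) + (if a = e then 1 else 0) +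
  (if b = c then 1 else 0) + (if b = d then 1 else 0) + (if b = e then 1 else 0) +
  (if c = d then 1 else 0) + (if c = e then 1 else 0) + (if d = e then 1 else 0)

/-- `v ∈ Δ₅` (content type `(2,2,1)`). -/
abbrev IsDoubling (v : Fin 5 → Fin 5) : Prop := pairCount (v 0) (v 1) (v 2) (v 3) (v 4) = 2

/-- Twice the defect `E` of the star border family of p629937 (`E = M₀₂⊗(R+U) + M₀₃⊗(R−U) − ½·M₀₄⊗R`,
`M = e₂₄+e₄₂`, `R = Arr{1,2,4}`, `U = Arr{0,2,4}`), as an integer function of the letters. -/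
def starDefect2 (a b c d e : Fin 5) : ℤ :=
  2 * (if (a = 2 ∧ c = 4) ∨ (a = 4 ∧ c = 2) then (1 : ℤ) else 0) *
      ((if (b = 1 ∧ d = 2 ∧ e = 4) ∨ (b = 1 ∧ d = 4 ∧ e = 2) ∨ (b = 2 ∧ d = 1 ∧ e = 4) ∨ (b = 2 ∧ d = 4 ∧ e = 1) ∨ (b = 4 ∧ d = 1 ∧ e = 2) ∨ (b = 4 ∧ d = 2 ∧ e = 1) then (1 : ℤ) else 0)
       + (if (b = 0 ∧ d = 2 ∧ e = 4) ∨ (b = 0 ∧ d = 4 ∧ e = 2) ∨ (b = 2 ∧ d = 0 ∧ e = 4) ∨ (b = 2 ∧ d = 4 ∧ e = 0) ∨ (b = 4 ∧ d = 0 ∧ e = 2) ∨ (b = 4 ∧ d = 2 ∧ e = 0) then (1 : ℤ) else 0))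
  + 2 * (if (a = 2 ∧ d = 4) ∨ (a = 4 ∧ d = 2) then (1 : ℤ) else 0) *
      ((if (b = 1 ∧ c = 2 ∧ e = 4) ∨ (b = 1 ∧ c = 4 ∧ e = 2) ∨ (b = 2 ∧ c = 1 ∧ e = 4) ∨ (b = 2 ∧ c = 4 ∧ e = 1) ∨ (b = 4 ∧ c = 1 ∧ e = 2) ∨ (b = 4 ∧ c = 2 ∧ e = 1) then (1 : ℤ) else 0)
       - (if (b = 0 ∧ c = 2 ∧ e = 4) ∨ (b = 0 ∧ c = 4 ∧ e = 2) ∨ (b = 2 ∧ c = 0 ∧ e = 4) ∨ (b = 2 ∧ c = 4 ∧ e = 0) ∨ (b = 4 ∧ c = 0 ∧ e = 2) ∨ (b = 4 ∧ c = 2 ∧ e = 0) then (1 : ℤ) else 0))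
  - (if (a = 2 ∧ e = 4) ∨ (a = 4 ∧ e = 2) then (1 : ℤ) else 0) *
      (if (b = 1 ∧ c = 2 ∧ d = 4) ∨ (b = 1 ∧ c = 4 ∧ d = 2) ∨ (b = 2 ∧ c = 1 ∧ d = 4) ∨ (b = 2 ∧ c = 4 ∧ d = 1) ∨ (b = 4 ∧ c = 1 ∧ d = 2) ∨ (b = 4 ∧ c = 2 ∧ d = 1) then (1 : ℤ) else 0)

/-- CALIBRATION (kernel): the star defect lives on the doubling stratum `Δ₅` only. -/
theorem starDefect2_on_doubling : ∀ a b c d e : Fin 5, starDefect2 a b c d e ≠ 0 → pairCount a b c d e = 2 := by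
  decide

/-- … and it is not zero (e.g. at the word `(2,1,4,2,4)` of content `{1,2,2,4,4}`). -/
theorem starDefect2_ne_zero : starDefect2 2 1 4 2 4 ≠ 0 := by decide

/-- IN-KERNEL CERTIFICATE of off-`Δ₅` exactness: the nine star terms of p629937 at `ε = 1` (doubled to stay in `ℤ`)
sum to `2·P₅ + starDefect2` on all `5⁵` words; with `starDefect2_on_doubling` they solve every non-`Δ₅` equation of `P₅`
exactly, with Laplace weight `108 < 120`. -/
theorem star_at_one : ∀ a b c d e : Fin 5,
      (2 : ℤ) * (if a = 0 ∧ b = 3 then (1 : ℤ) else 0) * ((2 : ℤ) * (if (c = 0 ∧ d = 1 ∧ e = 3) ∨ (c = 1 ∧ d = 0 ∧ e = 3) then (1 : ℤ) else 0) + (-2 : ℤ) * (if (c = 1 ∧ d = 3 ∧ e = 0) ∨ (c = 3 ∧ d = 1 ∧ e = 0) then (1 : ℤ) else 0) + (if (c = 1 ∧ d = 2 ∧ e = 4) ∨ (c = 1 ∧ d = 4 ∧ e = 2) ∨ (c = 2 ∧ d = 1 ∧ e = 4) ∨ (c = 2 ∧ d = 4 ∧ e = 1) ∨ (c = 4 ∧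 d = 1 ∧ e = 2) ∨ (c = 4 ∧ d = 2 ∧ e = 1) then (1 : ℤ) else 0))
      + (2 : ℤ) * (if (a = 1 ∧ b = 3) ∨ (a = 3 ∧ b = 1) then (1 : ℤ) else 0) * ((-1 : ℤ) * (if (c = 0 ∧ d = 1 ∧ e = 3) ∨ (c = 1 ∧ d = 3 ∧ e = 0) ∨ (c = 3 ∧ d = 0 ∧ e = 1) then (1 : ℤ) else 0) + (if (c = 0 ∧ d = 3 ∧ e = 1) ∨ (c = 1 ∧ d = 0 ∧ e = 3) ∨ (c = 3 ∧ d = 1 ∧ e = 0) then (1 : ℤ) else 0) + (if (c = 0 ∧ d = 2 ∧ e = 4) ∨ (c = 0 ∧ d = 4 ∧ e = 2) ∨ (c = 2 ∧ d = 0 ∧ e = 4) ∨ (c = 2 ∧ d = 4 ∧ e = 0) ∨ (c = 4 ∧ d = 0 ∧ e = 2) ∨ (c = 4 ∧ d = 2 ∧ e = 0) then (1 : ℤ) else 0))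
      + (2 : ℤ) * (if (a = 2 ∧ b = 4) ∨ (a = 4 ∧ b = 2) then (1 : ℤ) else 0) * (if (c = 0 ∧ d = 1 ∧ e = 3) ∨ (c = 0 ∧ d = 3 ∧ e = 1) ∨ (c = 1 ∧ d = 0 ∧ e = 3) ∨ (c = 1 ∧ d = 3 ∧ e = 0) ∨ (c = 3 ∧ d = 0 ∧ e = 1) ∨ (c = 3 ∧ d = 1 ∧ e = 0) then (1 : ℤ) else 0)
      + (2 : ℤ) * ((if a = 0 ∧ c = 3 then (1 : ℤ) else 0) + (if (a = 2 ∧ c = 4) ∨ (a = 4 ∧ c = 2) then (1 : ℤ) else 0)) * ((2 : ℤ) * (if (b = 0 ∧ d = 1 ∧ e = 3) ∨ (b = 1 ∧ d = 0 ∧ e = 3) ∨ (b = 3 ∧ d = 1 ∧ e = 0) then (1 : ℤ) else 0) + (if (b = 1 ∧ d = 2 ∧ e = 4) ∨ (b = 1 ∧ d = 4 ∧ e = 2) ∨ (b = 2 ∧ d = 1 ∧ e = 4) ∨ (b = 2 ∧ d = 4 ∧ e = 1) ∨ (b = 4 ∧ d = 1 ∧ e = 2) ∨ (b = 4 ∧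 d = 2 ∧ e = 1) then (1 : ℤ) else 0))
      + (2 : ℤ) * ((if (a = 1 ∧ c = 3) ∨ (a = 3 ∧ c = 1) then (1 : ℤ) else 0) + (if (a = 2 ∧ c = 4) ∨ (a = 4 ∧ c = 2) then (1 : ℤ) else 0)) * ((-1 : ℤ) * (if (b = 0 ∧ d = 1 ∧ e = 3) ∨ (b = 1 ∧ d = 0 ∧ e = 3) ∨ (b = 3 ∧ d = 1 ∧ e = 0) then (1 : ℤ) else 0) + (if (b = 0 ∧ d = 3 ∧ e = 1) ∨ (b = 1 ∧ d = 3 ∧ e = 0) ∨ (b = 3 ∧ d = 0 ∧ e = 1) then (1 : ℤ) else 0) + (if (b = 0 ∧ d = 2 ∧ e = 4) ∨ (b = 0 ∧ d = 4 ∧ e = 2) ∨ (b = 2 ∧ d = 0 ∧ e = 4) ∨ (b = 2 ∧ d = 4 ∧ e = 0) ∨ (b = 4 ∧ d = 0 ∧ e = 2) ∨ (b = 4 ∧ d = 2 ∧ e = 0) then (1 : ℤ) else 0))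
      + (2 : ℤ) * ((if a = 0 ∧ d = 3 then (1 : ℤ) else 0) + (if (a = 2 ∧ d = 4) ∨ (a = 4 ∧ d = 2) then (1 : ℤ) else 0)) * ((2 : ℤ) * (if (b = 0 ∧ c = 1 ∧ e = 3) ∨ (b = 1 ∧ c = 0 ∧ e = 3) ∨ (b = 3 ∧ c = 1 ∧ e = 0) then (1 : ℤ) else 0) + (if (b = 1 ∧ c = 2 ∧ e = 4) ∨ (b = 1 ∧ c = 4 ∧ e = 2) ∨ (b = 2 ∧ c = 1 ∧ e = 4) ∨ (b = 2 ∧ c = 4 ∧ e = 1) ∨ (b = 4 ∧ c = 1 ∧ e = 2) ∨ (b = 4 ∧ c = 2 ∧ e = 1) then (1 : ℤ) else 0))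
      + (2 : ℤ) * ((if (a = 1 ∧ d = 3) ∨ (a = 3 ∧ d = 1) then (1 : ℤ) else 0) + (-1 : ℤ) * (if (a = 2 ∧ d = 4) ∨ (a = 4 ∧ d = 2) then (1 : ℤ) else 0)) * ((if (b = 0 ∧ c = 1 ∧ e = 3) ∨ (b = 1 ∧ c = 0 ∧ e = 3) ∨ (b = 3 ∧ c = 1 ∧ e = 0) then (1 : ℤ) else 0) + (-1 : ℤ) * (if (b = 0 ∧ c = 3 ∧ e = 1) ∨ (b = 1 ∧ c = 3 ∧ e = 0) ∨ (b = 3 ∧ c = 0 ∧ e = 1) then (1 : ℤ) else 0) + (if (b = 0 ∧ c = 2 ∧ e = 4) ∨ (b = 0 ∧ c = 4 ∧ e = 2) ∨ (b = 2 ∧ c = 0 ∧ e = 4) ∨ (b = 2 ∧ c = 4 ∧ e = 0) ∨ (b = 4 ∧ c = 0 ∧ e = 2) ∨ (b = 4 ∧ c = 2 ∧ e = 0) then (1 : ℤ) else 0))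
      + ((2 : ℤ) * (if a = 0 ∧ e = 3 then (1 : ℤ) else 0) + (-1 : ℤ) * (if (a = 2 ∧ e = 4) ∨ (a = 4 ∧ e = 2) then (1 : ℤ) else 0)) * ((-2 : ℤ) * (if (b = 0 ∧ c = 1 ∧ d = 3) ∨ (b = 0 ∧ c = 3 ∧ d = 1) ∨ (b = 1 ∧ c = 0 ∧ d = 3) ∨ (b = 1 ∧ c = 3 ∧ d = 0) ∨ (b = 3 ∧ c = 0 ∧ d = 1) ∨ (b = 3 ∧ c = 1 ∧ d = 0) then (1 : ℤ) else 0) + (if (b = 1 ∧ c = 2 ∧ d = 4) ∨ (b = 1 ∧ c = 4 ∧ d = 2) ∨ (b = 2 ∧ c = 1 ∧ d = 4) ∨ (b = 2 ∧ c = 4 ∧ d = 1) ∨ (b = 4 ∧ c = 1 ∧ d = 2) ∨ (b = 4 ∧ c = 2 ∧ d = 1) then (1 : ℤ) else 0))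
      + (2 : ℤ) * (if (a = 1 ∧ e = 3) ∨ (a = 3 ∧ e = 1) then (1 : ℤ) else 0) * ((-1 : ℤ) * (if (b = 0 ∧ c = 1 ∧ d = 3) ∨ (b = 1 ∧ c = 0 ∧ d = 3) ∨ (b = 3 ∧ c = 1 ∧ d = 0) then (1 : ℤ) else 0) + (if (b = 0 ∧ c = 3 ∧ d = 1) ∨ (b = 1 ∧ c = 3 ∧ d = 0) ∨ (b = 3 ∧ c = 0 ∧ d = 1) then (1 : ℤ) else 0) + (if (b = 0 ∧ c = 2 ∧ d = 4) ∨ (b = 0 ∧ c = 4 ∧ d = 2) ∨ (b = 2 ∧ c = 0 ∧ d = 4) ∨ (b = 2 ∧ c = 4 ∧ d = 0) ∨ (b = 4 ∧ c = 0 ∧ d = 2) ∨ (b = 4 ∧ c = 2 ∧ d = 0) then (1 : ℤ) else 0))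
      = 2 * (if (a ≠ b ∧ a ≠ c ∧ a ≠ d ∧ a ≠ e ∧ b ≠ c ∧ b ≠ d ∧ b ≠ e ∧ c ≠ d ∧ c ≠ e ∧ d ≠ e) then (1 : ℤ) else 0)
        + starDefect2 a b c d e := by
  decide

/-- A `Δ₅`-word is never injective (letters form). -/
theorem pairCount_two_not_pairwise : ∀ a b c d e : Fin 5, pairCount a b c d e = 2 →
    ¬ (a ≠ b ∧ a ≠ c ∧ a ≠ d ∧ a ≠ e ∧ b ≠ c ∧ b ≠ d ∧ b ≠ e ∧ c ≠ d ∧ c ≠ e ∧ d ≠ e) := by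
  decide

theorem not_injective_of_isDoubling (v : Fin 5 → Fin 5) (h : IsDoubling v) : ¬ Function.Injective v := by
  rw [injective_iff_pairwise]
  exact pairCount_two_not_pairwise (v 0) (v 1) (v 2) (v 3) (v 4) h

/-- The two cylinder conditions of `LaplaceOptimal 5` for a term system `(S, u, w)`. -/
def Cylindrical {N : ℕ} (S : Fin N → Finset (Fin 5)) (u w : Fin N → (Fin 5 → Fin 5) → ℂ) : Prop :=
  (∀ t, ∀ v v' : Fin 5 → Fin 5, (∀ i ∈ S t, v i = v' i) → u t v = u t v') ∧
  (∀ t, ∀ v v' : Fin 5 → Fin 5, (∀ i, i ∉ S t → v i = v' i) → w t v = w t v')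

/-- Laplace weight of the profile. -/
def weight {N : ℕ} (T : Finset (Fin N)) (S : Fin N → Finset (Fin 5)) : ℕ :=
  ∑ t ∈ T, (S t).card.factorial * (5 - (S t).card).factorial

/-- `D = (T, S, u, w)` is a point of the OFF-DOUBLING SOLUTION VARIETY `𝒟^off`: it reproduces `P₅` at every word
outside `Δ₅` (injective words ↦ 1, all other non-`Δ₅` words ↦ 0). -/
def OffDoublingSolution {N : ℕ} (T : Finset (Fin N)) (S : Fin N → Finset (Fin 5))
    (u w : Fin N → (Fin 5 → Fin 5) → ℂ) : Prop :=
  Cylindrical S u w ∧ ∀ v : Fin 5 → Fin 5, ¬ IsDoubling v → (∑ t ∈ T, u t v * w t v) = if Function.Injective v then 1 else 0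

/-- The `Δ₅`-RESIDUE of a term system: its value on the doubling stratum (zero elsewhere by convention). -/
def residue {N : ℕ} (T : Finset (Fin N)) (u w : Fin N → (Fin 5 → Fin 5) → ℂ) : (Fin 5 → Fin 5) → ℂ :=
  fun v => if IsDoubling v then ∑ t ∈ T, u t v * w t v else 0

/-- RESIDUE FORM of the crux (proved): `LaplaceOptimalFive` ⟺ no cheap point of `𝒟^off` has zero `Δ₅`-residue,
i.e. the linear system `{Res_w}_{w ∈ Δ₅}` is base-point free on the cheap part of `𝒟^off`. -/
theorem laplaceOptimalFive_iff_doublingResidue :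
    Summit.ValiantsHypothesis.ValiantsHypothesis.Theses.RigidityForcesSymmetry.LaplaceOptimalFive ↔
    ∀ (N : ℕ) (T : Finset (Fin N)) (S : Fin N → Finset (Fin 5)) (u w : Fin N → (Fin 5 → Fin 5) → ℂ),
      OffDoublingSolution T S u w → weight T S < Nat.factorial 5 → ∃ v, IsDoubling v ∧ residue T u w v ≠ 0 := by
  constructor
  · intro h N T S u w hD hlt
    by_contra hnone
    push Not at hnone
    have hfull : ∀ v : Fin 5 → Fin 5, (∑ t ∈ T, u t v * w t v) = if Function.Injective v then 1 else 0 := by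
      intro v
      by_cases hv : IsDoubling v
      · have h0 : residue T u w v = 0 := hnone v hv
        unfold residue at h0
        rw [if_pos hv] at h0
        rw [h0, if_neg (not_injective_of_isDoubling v hv)]
      · exact hD.2 v hv
    have := h N T S u w hD.1.1 hD.1.2 hfull
    exact absurd hlt (not_lt.mpr this)
  · intro h N T S u w hu hw hsum
    by_contra hlt
    push Not at hlt
    obtain ⟨v, hv, hne⟩ := h N T S u w ⟨⟨hu, hw⟩, fun v _ => hsum v⟩ hlt
    apply hne
    unfold residue
    rw [if_pos hv, hsum v, if_neg (not_injective_of_isDoubling v hv)]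

/-- CONSERVATION-LAW form (proved from the residue form, stated for the record): on `𝒟^off`, zero residue forces
weight `≥ 120`.  (The graded version `weight D + κ(residue D) ≥ 120`, `κ` = cleaning cost, is equivalent and is the
quantity the idea card proposes to bound.) -/
theorem weight_ge_of_residue_zero
    (h : Summit.ValiantsHypothesis.ValiantsHypothesis.Theses.RigidityForcesSymmetry.LaplaceOptimalFive)
    {N : ℕ} (T : Finset (Fin N)) (S : Fin N → Finset (Fin 5)) (u w : Fin N → (Fin 5 → Fin 5) → ℂ)
    (hD : OffDoublingSolution T S u w) (hres : ∀ v, residue T u w v = 0) : Nat.factorial 5 ≤ weight T S := by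
  by_contra hlt
  push Not at hlt
  obtain ⟨v, _, hne⟩ := (laplaceOptimalFive_iff_doublingResidue.1 h) N T S u w hD hlt
  exact hne (hres v)

/-- The star profile `3·{0,1} + 2·{0,2} + 2·{0,3} + 2·{0,4}` (weight 108) of the certified border family. -/
def starProfile : Fin 9 → Finset (Fin 5) := ![{0, 1}, {0, 1}, {0, 1}, {0, 2}, {0, 2}, {0, 3}, {0, 3}, {0, 4}, {0, 4}]

/-- P1 (support; re-derivation of p629937 at `ε = 1` in residue form): the star stratum of `𝒟^off` is NON-EMPTY and
carries the non-zero residue `E = starDefect2 / 2`.  So `LaplaceOptimalFive` is invisible off `Δ₅`. -/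
theorem stub_star_offDoubling_witness :
    ∃ (u w : Fin 9 → (Fin 5 → Fin 5) → ℂ), OffDoublingSolution Finset.univ starProfile u w ∧
      ∀ v, residue Finset.univ u w v = (starDefect2 (v 0) (v 1) (v 2) (v 3) (v 4) : ℂ) / 2 := by
  sorry

/-- K1 (crux of the line, rank 2; the star-profile case of the residue form): every point of the star stratum of
`𝒟^off` (any sub-multiset `T` of the star profile) has non-zero `Δ₅`-residue.  OPEN. -/
theorem stub_star_residue_ne_zero :
    ∀ (T : Finset (Fin 9)) (u w : Fin 9 → (Fin 5 → Fin 5) → ℂ),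
      OffDoublingSolution T starProfile u w → ∃ v, IsDoubling v ∧ residue T u w v ≠ 0 := by
  sorry

/-- ON-SHELL factors: `u t` vanishes unless `v` is injective on `S t` and depends only on the SET `v '' (S t)`
(symmetric, square-free), and likewise `w t` on the complement.  All certified cheap mechanisms (d = 4, 5, 6 border,
d = 6 exact) use OFF-shell factors (`e₀₃`, `e₀₂ − e₂₀`, diagonal killers). -/
def OnShell {N : ℕ} (S : Fin N → Finset (Fin 5)) (u w : Fin N → (Fin 5 → Fin 5) → ℂ) : Prop :=
  (∀ t v, ((S t).image v).card < (S t).card → u t v = 0) ∧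
  (∀ t v v', (S t).image v = (S t).image v' → u t v = u t v') ∧
  (∀ t v, (((S t)ᶜ).image v).card < ((S t)ᶜ).card → w t v = 0) ∧
  (∀ t v v', ((S t)ᶜ).image v = ((S t)ᶜ).image v' → w t v = w t v')

/-- K2 (rung, rank 3): ON-SHELL `LaplaceOptimal 5` — cheap systems with on-shell factors never decompose `P₅`.
Candidate first rung NOT known to be border-false (the star family is off-shell); its equations decouple by
`|A ∩ B|` into the injective / depth-1 / `Δ₅` blocks.  OPEN (plausibly finite linear algebra). -/
theorem stub_onShell_five :
    ∀ (N : ℕ) (T : Finset (Fin N)) (S : Fin N → Finset (Fin 5)) (u w : Fin N → (Fin 5 → Fin 5) → ℂ),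
      Cylindrical S u w → OnShell S u w →
      (∀ v : Fin 5 → Fin 5, (∑ t ∈ T, u t v * w t v) = if Function.Injective v then 1 else 0) →
      Nat.factorial 5 ≤ weight T S := by
  sorry

/-- ASSEMBLY of the line (kernel-checked modulo nothing: pure logic): the residue form at ALL cheap profiles is the
crux; K1 is its star-profile instance.  (`LaplaceOptimalFive` itself stays OPEN.) -/
theorem laplaceOptimalFive_of_residue
    (h : ∀ (N : ℕ) (T : Finset (Fin N)) (S : Fin N → Finset (Fin 5)) (u w : Fin N → (Fin 5 → Fin 5) → ℂ),
      OffDoublingSolution T S u w → weight T S < Nat.factorial 5 → ∃ v, IsDoubling v ∧ residue T u w v ≠ 0) :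
    Summit.ValiantsHypothesis.ValiantsHypothesis.Theses.RigidityForcesSymmetry.LaplaceOptimalFive :=
  laplaceOptimalFive_iff_doublingResidue.2 h

end Summit.ValiantsHypothesis.ValiantsHypothesis.Cruxes.LaplaceOptimalFive.DoublingStratumResidue
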